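import Mathlib
import Summits.NavierStokesRegularity.NavierStokesRegularity.Theorems.EulerZoomLiouvillePowerGaugeEulerLiouvilleVorticityBirth
import Summits.NavierStokesRegularity.NavierStokesRegularity.Theorems.EulerZoomLiouvillePowerGaugeEulerLiouvilleDSSCompactVorticity
import HarnessLib.Audit

/-!
# Crux E `PowerGaugeEulerLiouville` (stmt-NavierStokesRegularity-19832): PIERCING AT THE MOVING SIMILARITY SPHERES, PHYSICAL VARIABLES —
# the first-exit / two-time Cauchy assembly of the LEAD's key K-A «DSS piercing», MODULO the confined-null alternative

Route `EulerZoomLiouville` (NavierStokesRegularity), crux E, LEAD ns-typeII-p2's key K-A (the discretely-self-similar twin of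
`Loc.selfSimilar_ae_eq_zero_of_piercingIrrotationalC2_profile`).  Physical variables throughout.  Let `(u, p)` be classical Euler on
`(−∞, 0)` with a continuous-in-time gradient bound `‖∇u(s, ·)‖ ≤ Λ(s)` (the Cauchy–Lipschitz setting of `…VorticityBirth`: the backward
particle trajectories `σ ↦ φ(σ; τ₀, x₀) = ODE.evolutionMap u τ₀ σ x₀` exist for all `σ < 0` and carry the vorticity by the two-time Cauchy
formula).  Fix a similarity exponent `n` (for Seregin's class `n = 1/(2+ρ)`) and the MOVING SPHERES `‖x‖ = R(−σ)ⁿ`.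

* `curl_eq_zero_of_exit` — FIRST EXIT + FERMAT + CAUCHY: if on the moving sphere of radius `R` the vorticity vanishes at every FAST-INFLOW
  point (`⟪x, u σ x⟫ ≤ −n‖x‖²/(−σ)`, i.e. the particle enters the shrinking ball at least as fast as the similarity drift) at all times
  `σ ≤ τ₀`, and the backward trajectory of `(τ₀, x₀)`, `‖x₀‖ < R(−τ₀)ⁿ`, is NOT confined (`‖φ(σ)‖ ≥ R(−σ)ⁿ` for some `σ ≤ τ₀`), then
  `curl u(τ₀, x₀) = 0`: at the LAST crossing time `σ₁ < τ₀` the function `‖φ(σ)‖² − R²(−σ)^{2n}` has a one-sided maximum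
  (`IsLocalMaxOn.hasFDerivWithinAt_nonpos`), which is exactly the fast-inflow inequality at `(σ₁, φ(σ₁))`; the vorticity vanishes there and
  is transported to `(τ₀, x₀)` by `VorticityBirth.curl_eq_fderiv_evolutionMap_apply_two_time_local`.
* `curl_eq_zero_of_piercing_of_confinedNull` — hence, if spheres of radii `R` beyond every bound are pierced only irrotationally (at
  fast-inflow points) and the CONFINED ALTERNATIVE IS NULL (binder `hconf`: for every `τ₀ < 0`, `R > 0` the vortical points of the slice `τ₀`
  whose backward trajectory stays inside the moving ball have measure zero — for DSS members this is the nonautonomous-periodic twin of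
  ns-typeII-p1's `Loc.volume_vortical_confined_eq_zero`, the one new lemma of K-A, NOT proved here), then `curl u ≡ 0` on the past
  (the vortical set of a slice is open and null);
* `ae_eq_zero_of_gauge_of_piercing_of_confinedNull` — with the crux hypotheses (`0 < ρ ≤ ½`) the member is trivial
  (`PastIrrotational.ae_eq_zero_of_gauge_of_pastIrrotational`).

WHAT THIS IS NOT: not NS regularity, not the crux E, not K-A: the confined-null alternative is an explicit HYPOTHESIS here.
[folklore; ConstantinIgnatovaVicol2026Putative §3.4.1 (3.22)–(3.24) mechanism in physical variables]
-/

noncomputable section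

set_option linter.dupNamespace false

open MeasureTheory Set Filter Topology Metric Function
open scoped NNReal ENNReal ContDiff InnerProductSpace RealInnerProductSpace

namespace Summit.NavierStokesRegularity.NavierStokesRegularity.Theorems.PowerGaugeEulerLiouville.MovingSpherePiercing

open Literature.Analysis Literature.Analysis.FluidPDE Literature.Analysis.FunctionSpaces
open Summit.NavierStokesRegularity.NavierStokesRegularity.Theorems.PowerGaugeEulerLiouville.VorticityBirth

variable {u : ℝ → EuclideanSpace ℝ (Fin 3) → EuclideanSpace ℝ (Fin 3)} {p : ℝ → EuclideanSpace ℝ (Fin 3) → ℝ} {Λ : ℝ → ℝ}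
  {n : ℝ}

/-- The moving radius `σ ↦ R²(−σ)^{2n}` is differentiable at `σ < 0` with derivative `−2nR²(−σ)^{2n−1}`. [folklore] -/
theorem hasDerivAt_movingRadiusSq (R n : ℝ) {σ : ℝ} (hσ : σ < 0) :
    HasDerivAt (fun s : ℝ => R ^ 2 * (-s) ^ (2 * n)) (R ^ 2 * (-(2 * n * (-σ) ^ (2 * n - 1)))) σ := by
  have h := ((hasDerivAt_neg σ).rpow_const (p := 2 * n) (Or.inl (by linarith : -σ ≠ 0))).const_mul (R ^ 2)
  refine h.congr_deriv ?_
  ring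

/-- **FIRST EXIT + FERMAT + CAUCHY.**  Classical Euler on `(−∞,0)` with gradient bound `Λ`; on the moving sphere `‖x‖ = R(−σ)ⁿ` the
vorticity vanishes at every fast-inflow point, for all `σ ≤ τ₀`; the backward trajectory of `(τ₀, x₀)` (`‖x₀‖ < R(−τ₀)ⁿ`) reaches the
sphere at some `σ ≤ τ₀`.  Then `curl u(τ₀, x₀) = 0`. [folklore] -/
theorem curl_eq_zero_of_exit (hcl : IsClassicalEulerSolutionOn (Iio 0) 0 u p) (hΛc : ContinuousOn Λ (Iio 0))
    (hΛ : ∀ s : ℝ, s < 0 → ∀ y, ‖fderiv ℝ (u s) y‖ ≤ Λ s) {R τ₀ : ℝ} (hR : 0 < R) (hτ₀ : τ₀ < 0)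
    (hS : ∀ σ : ℝ, σ ≤ τ₀ → ∀ x : EuclideanSpace ℝ (Fin 3), ‖x‖ = R * (-σ) ^ n →
      ⟪x, u σ x⟫ ≤ -(n * ‖x‖ ^ 2 / (-σ)) → curl (u σ) x = 0)
    {x₀ : EuclideanSpace ℝ (Fin 3)} (hx₀ : ‖x₀‖ < R * (-τ₀) ^ n)
    (hexit : ∃ σ : ℝ, σ ≤ τ₀ ∧ R * (-σ) ^ n ≤ ‖ODE.evolutionMap u τ₀ σ x₀‖) :
    curl (u τ₀) x₀ = 0 := by
  have hlip : ODE.IsUniformlyLipschitzOn u (Iio 0) := isUniformlyLipschitzOn hcl hΛc hΛ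
  set X : ℝ → EuclideanSpace ℝ (Fin 3) := fun σ => ODE.evolutionMap u τ₀ σ x₀ with hX
  have hXc : ContinuousOn X (Iio 0) := hlip.continuousOn_evolutionMap (convex_Iio 0) hτ₀ x₀
  have hXd : ∀ σ : ℝ, σ < 0 → HasDerivAt X (u σ (X σ)) σ := fun σ hσ =>
    hlip.hasDerivAt_evolutionMap (convex_Iio 0) hτ₀ (Iio_mem_nhds hσ) x₀
  have hX0 : X τ₀ = x₀ := ODE.evolutionMap_self u τ₀ x₀
  -- the crossing function `f σ = ‖X σ‖² − R²(−σ)^{2n}`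
  set f : ℝ → ℝ := fun σ => ‖X σ‖ ^ 2 - R ^ 2 * (-σ) ^ (2 * n) with hf
  have hfc : ContinuousOn f (Iio 0) := by
    refine (hXc.norm.pow 2).sub (continuousOn_const.mul ((continuousOn_neg).rpow_const fun σ hσ => Or.inl ?_))
    exact (neg_pos.2 (mem_Iio.1 hσ)).ne'
  have hsq : ∀ σ : ℝ, σ < 0 → (R * (-σ) ^ n) ^ 2 = R ^ 2 * (-σ) ^ (2 * n) := by
    intro σ hσ
    rw [mul_pow, ← Real.rpow_natCast ((-σ) ^ n) 2, ← Real.rpow_mul (by linarith)]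
    push_cast; ring_nf
  have hfneg : f τ₀ < 0 := by
    have h1 : ‖X τ₀‖ ^ 2 < (R * (-τ₀) ^ n) ^ 2 := by
      rw [hX0]; exact pow_lt_pow_left₀ hx₀ (norm_nonneg _) two_ne_zero
    simp only [hf]; rw [← hsq τ₀ hτ₀]; linarith
  obtain ⟨σs, hσs, hσsR⟩ := hexit
  have hσs0 : σs < 0 := lt_of_le_of_lt hσs hτ₀
  have hfσs : 0 ≤ f σs := by
    have hRn : 0 ≤ R * (-σs) ^ n := mul_nonneg hR.le (Real.rpow_nonneg (by linarith) _)
    have h1 : (R * (-σs) ^ n) ^ 2 ≤ ‖X σs‖ ^ 2 := pow_le_pow_left₀ hRn hσsR 2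
    simp only [hf]; rw [← hsq σs hσs0]; linarith
  -- the LAST crossing time `σ₁ = sup {σ ∈ [σs, τ₀] : f σ ≥ 0}`
  set T : Set ℝ := {σ | σ ∈ Icc σs τ₀ ∧ 0 ≤ f σ} with hT
  have hTne : T.Nonempty := ⟨σs, ⟨le_rfl, hσs⟩, hfσs⟩
  have hTbdd : BddAbove T := ⟨τ₀, fun σ hσ => hσ.1.2⟩
  have hTcl : IsClosed T := by
    have hIcc : Icc σs τ₀ ⊆ Iio 0 := fun σ hσ => lt_of_le_of_lt hσ.2 hτ₀
    have h1 : IsClosed {σ ∈ Icc σs τ₀ | 0 ≤ f σ} :=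
      (hfc.mono hIcc).preimage_isClosed_of_isClosed isClosed_Icc isClosed_Ici
    convert h1 using 1
  set σ₁ : ℝ := sSup T with hσ₁
  have hσ₁T : σ₁ ∈ T := hTcl.csSup_mem hTne hTbdd
  have hσ₁le : σ₁ ≤ τ₀ := hσ₁T.1.2
  have hσ₁0 : σ₁ < 0 := lt_of_le_of_lt hσ₁le hτ₀
  have hσ₁lt : σ₁ < τ₀ := by
    rcases hσ₁le.lt_or_eq with h | h
    · exact h
    · exfalso; have := hσ₁T.2; rw [h] at this; linarith
  have hafter : ∀ σ, σ₁ < σ → σ ≤ τ₀ → f σ < 0 := by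
    intro σ h1 h2
    by_contra hge
    push Not at hge
    have : σ ≤ σ₁ := le_csSup hTbdd ⟨⟨(hσ₁T.1.1).trans h1.le, h2⟩, hge⟩
    linarith
  -- `f σ₁ = 0` (continuity from the right)
  have hf₁ : f σ₁ = 0 := by
    refine le_antisymm ?_ hσ₁T.2
    by_contra hgt
    push Not at hgt
    have hca : ContinuousAt f σ₁ := hfc.continuousAt (Iio_mem_nhds hσ₁0)
    have hev : ∀ᶠ σ in 𝓝 σ₁, 0 < f σ := hca.eventually (lt_mem_nhds hgt)
    obtain ⟨δ, hδ, hball⟩ := Metric.eventually_nhds_iff.1 hev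
    set σ : ℝ := min (σ₁ + δ / 2) τ₀ with hσdef
    have h1 : σ₁ < σ := lt_min (by linarith) hσ₁lt
    have h2 : σ ≤ τ₀ := min_le_right _ _
    have hdist : dist σ σ₁ < δ := by
      rw [Real.dist_eq, abs_of_nonneg (by linarith)]
      have : σ ≤ σ₁ + δ / 2 := min_le_left _ _
      linarith
    have := hball hdist
    have := hafter σ h1 h2
    linarith
  have hnorm₁ : ‖X σ₁‖ = R * (-σ₁) ^ n := by
    have hRn : 0 ≤ R * (-σ₁) ^ n := mul_nonneg hR.le (Real.rpow_nonneg (by linarith) _)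
    have h1 : ‖X σ₁‖ ^ 2 = (R * (-σ₁) ^ n) ^ 2 := by
      rw [hsq σ₁ hσ₁0]; simp only [hf] at hf₁; linarith
    exact (pow_left_inj₀ (norm_nonneg _) hRn two_ne_zero).1 h1
  -- Fermat at the one-sided maximum of `f` on `[σ₁, τ₀]`: `f′(σ₁) ≤ 0`
  have hf' : HasDerivAt f (2 * ⟪X σ₁, u σ₁ (X σ₁)⟫ - R ^ 2 * (-(2 * n * (-σ₁) ^ (2 * n - 1)))) σ₁ :=
    (hXd σ₁ hσ₁0).norm_sq.sub (hasDerivAt_movingRadiusSq R n hσ₁0)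
  have hmax : IsLocalMaxOn f (Icc σ₁ τ₀) σ₁ := by
    refine Filter.eventually_of_mem self_mem_nhdsWithin fun σ hσ => ?_
    rw [hf₁]
    rcases hσ.1.lt_or_eq with h | h
    · exact (hafter σ h hσ.2).le
    · rw [← h, hf₁]
  have hcone : (τ₀ - σ₁) ∈ posTangentConeAt (Icc σ₁ τ₀) σ₁ := by
    refine mem_posTangentConeAt_of_segment_subset ?_
    rw [show σ₁ + (τ₀ - σ₁) = τ₀ by ring, segment_eq_Icc hσ₁le]
  have hfermat := hmax.hasFDerivWithinAt_nonpos hf'.hasFDerivAt.hasFDerivWithinAt hcone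
  have hderiv : 2 * ⟪X σ₁, u σ₁ (X σ₁)⟫ - R ^ 2 * (-(2 * n * (-σ₁) ^ (2 * n - 1))) ≤ 0 := by
    have h1 : (τ₀ - σ₁) • (2 * ⟪X σ₁, u σ₁ (X σ₁)⟫ - R ^ 2 * (-(2 * n * (-σ₁) ^ (2 * n - 1)))) ≤ 0 := by
      simpa using hfermat
    rw [smul_eq_mul] at h1
    have h2 : 0 < τ₀ - σ₁ := by linarith
    by_contra hlt
    push Not at hlt
    have := mul_pos h2 hlt
    linarith
  -- the fast-inflow inequality at `(σ₁, X σ₁)`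
  have hfast : ⟪X σ₁, u σ₁ (X σ₁)⟫ ≤ -(n * ‖X σ₁‖ ^ 2 / (-σ₁)) := by
    have hpos : 0 < -σ₁ := by linarith
    have hn2 : ‖X σ₁‖ ^ 2 = R ^ 2 * (-σ₁) ^ (2 * n) := by rw [hnorm₁, hsq σ₁ hσ₁0]
    have hkey : n * ‖X σ₁‖ ^ 2 / (-σ₁) = n * R ^ 2 * (-σ₁) ^ (2 * n - 1) := by
      rw [hn2, Real.rpow_sub hpos, Real.rpow_one]
      field_simp
    rw [hkey]
    linarith [hderiv]
  have hcurl₁ : curl (u σ₁) (X σ₁) = 0 := hS σ₁ hσ₁le (X σ₁) hnorm₁ hfast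
  -- transport to `(τ₀, x₀)` by the two-time Cauchy formula
  rw [curl_eq_fderiv_evolutionMap_apply_two_time_local hcl hΛc hΛ hσ₁0 hτ₀ x₀]
  simp only [hX] at hcurl₁
  rw [hcurl₁, map_zero]

/-- **PIERCING AT MOVING SPHERES BEYOND EVERY RADIUS + CONFINED-NULL ⇒ IRROTATIONAL PAST.**  Classical Euler on `(−∞, 0)` with a
continuous gradient bound; spheres `‖x‖ = R(−σ)ⁿ` with `R` beyond every bound on which, at all times `σ < 0`, the vorticity vanishes at
every fast-inflow point; and (HYPOTHESIS `hconf`, the confined alternative) for every slice `τ₀ < 0` and radius `R > 0` the vortical points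
whose backward trajectory stays inside the moving ball are Lebesgue-null.  Then `curl u(τ₀) ≡ 0` for every `τ₀ < 0` (the vortical set of
a slice is open; inside a large moving ball it consists of confined points only, by `curl_eq_zero_of_exit`). [folklore] -/
theorem curl_eq_zero_of_piercing_of_confinedNull (hcl : IsClassicalEulerSolutionOn (Iio 0) 0 u p) (hΛc : ContinuousOn Λ (Iio 0))
    (hΛ : ∀ s : ℝ, s < 0 → ∀ y, ‖fderiv ℝ (u s) y‖ ≤ Λ s)
    (hS : ∀ R₀ : ℝ, ∃ R : ℝ, R₀ ≤ R ∧ ∀ σ : ℝ, σ < 0 → ∀ x : EuclideanSpace ℝ (Fin 3), ‖x‖ = R * (-σ) ^ n →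
      ⟪x, u σ x⟫ ≤ -(n * ‖x‖ ^ 2 / (-σ)) → curl (u σ) x = 0)
    (hconf : ∀ τ₀ : ℝ, τ₀ < 0 → ∀ R : ℝ, 0 < R →
      volume {x : EuclideanSpace ℝ (Fin 3) | curl (u τ₀) x ≠ 0 ∧
        ∀ σ : ℝ, σ ≤ τ₀ → ‖ODE.evolutionMap u τ₀ σ x‖ < R * (-σ) ^ n} = 0)
    {τ₀ : ℝ} (hτ₀ : τ₀ < 0) (x₀ : EuclideanSpace ℝ (Fin 3)) : curl (u τ₀) x₀ = 0 := by
  by_contra hne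
  have hpow : 0 < (-τ₀) ^ n := Real.rpow_pos_of_pos (by linarith) _
  obtain ⟨R, hR₀, hSR⟩ := hS (max (‖x₀‖ / (-τ₀) ^ n + 1) 1)
  have hR : 0 < R := lt_of_lt_of_le one_pos ((le_max_right _ _).trans hR₀)
  have hx₀ : ‖x₀‖ < R * (-τ₀) ^ n := by
    have h1 : ‖x₀‖ / (-τ₀) ^ n + 1 ≤ R := (le_max_left _ _).trans hR₀
    rw [← div_lt_iff₀ hpow]
    linarith
  -- the open set of vortical points inside the moving ball at time `τ₀`
  set O : Set (EuclideanSpace ℝ (Fin 3)) := {x | curl (u τ₀) x ≠ 0 ∧ ‖x‖ < R * (-τ₀) ^ n} with hO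
  have hcont : Continuous (curl (u τ₀)) :=
    (contDiff_curl (n := 0) ((hcl.contDiff_velocity hτ₀).of_le (by norm_cast))).continuous
  have hOo : IsOpen O := by
    rw [hO, setOf_and]
    exact (isOpen_ne_fun hcont continuous_const).inter (isOpen_lt continuous_norm continuous_const)
  have hOpos : 0 < volume O := hOo.measure_pos volume ⟨x₀, hne, hx₀⟩
  -- every point of `O` is confined
  have hsub : O ⊆ {x : EuclideanSpace ℝ (Fin 3) | curl (u τ₀) x ≠ 0 ∧
      ∀ σ : ℝ, σ ≤ τ₀ → ‖ODE.evolutionMap u τ₀ σ x‖ < R * (-σ) ^ n} := by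
    rintro x ⟨hx, hxR⟩
    refine ⟨hx, fun σ hσ => ?_⟩
    by_contra hge
    push Not at hge
    exact hx (curl_eq_zero_of_exit hcl hΛc hΛ hR hτ₀ (fun σ hσ' x hx' hfast => hSR σ (lt_of_le_of_lt hσ' hτ₀) x hx' hfast)
      hxR ⟨σ, hσ, hge⟩)
  have : volume O = 0 := measure_mono_null hsub (hconf τ₀ hτ₀ R hR)
  exact hOpos.ne' this

/-- **THE STRATUM, MODULO THE CONFINED ALTERNATIVE** (LEAD ns-typeII-p2's key K-A in physical variables, with the nonautonomous
confined-null lemma as the explicit binder `hconf`).  Crux hypotheses verbatim (`0 < ρ ≤ ½`) + `(u, p)` classical Euler on the past with a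
continuous gradient bound + irrotational piercing of the moving similarity spheres `‖x‖ = R(−σ)ⁿ` beyond every radius + `hconf`
⇒ `u = 0` a.e. on `(−∞, 0) × ℝ³` (`PastIrrotational.ae_eq_zero_of_gauge_of_pastIrrotational`). [folklore] -/
theorem ae_eq_zero_of_gauge_of_piercing_of_confinedNull {ρ : ℝ} (hρ : 0 < ρ) (hρh : ρ ≤ 1 / 2)
    {H : ℝ → EuclideanSpace ℝ (Fin 3) → EuclideanSpace ℝ (Fin 3) →L[ℝ] EuclideanSpace ℝ (Fin 3)} {c₀ : ℝ≥0}
    (hsw : IsSuitableWeakSolutionOn (slab (EuclideanSpace ℝ (Fin 3)) (Iio 0) isOpen_Iio) 0 0 u p)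
    (hH : HasWeakSpatialGradientOn (slab (EuclideanSpace ℝ (Fin 3)) (Iio 0) isOpen_Iio) u H)
    (hgauge : ∀ a : ℝ, 0 < a →
      ENNReal.ofReal (a ^ (2 * ρ)) * cknA a (0 : ℝ × EuclideanSpace ℝ (Fin 3)) u +
          ENNReal.ofReal (a ^ ρ) * cknE a (0 : ℝ × EuclideanSpace ℝ (Fin 3)) H +
        ENNReal.ofReal (a ^ (2 * ρ)) * cknD a (0 : ℝ × EuclideanSpace ℝ (Fin 3)) p ≤ (c₀ : ℝ≥0∞))
    (hcl : IsClassicalEulerSolutionOn (Iio 0) 0 u p) (hΛc : ContinuousOn Λ (Iio 0))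
    (hΛ : ∀ s : ℝ, s < 0 → ∀ y, ‖fderiv ℝ (u s) y‖ ≤ Λ s)
    (hS : ∀ R₀ : ℝ, ∃ R : ℝ, R₀ ≤ R ∧ ∀ σ : ℝ, σ < 0 → ∀ x : EuclideanSpace ℝ (Fin 3), ‖x‖ = R * (-σ) ^ n →
      ⟪x, u σ x⟫ ≤ -(n * ‖x‖ ^ 2 / (-σ)) → curl (u σ) x = 0)
    (hconf : ∀ τ₀ : ℝ, τ₀ < 0 → ∀ R : ℝ, 0 < R →
      volume {x : EuclideanSpace ℝ (Fin 3) | curl (u τ₀) x ≠ 0 ∧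
        ∀ σ : ℝ, σ ≤ τ₀ → ‖ODE.evolutionMap u τ₀ σ x‖ < R * (-σ) ^ n} = 0) :
    uncurry u =ᵐ[volume.restrict (Iio (0 : ℝ) ×ˢ (univ : Set (EuclideanSpace ℝ (Fin 3))))] 0 :=
  PastIrrotational.ae_eq_zero_of_gauge_of_pastIrrotational hρ hρh hsw hH hgauge le_rfl
    (fun _ hτ => (hcl.contDiff_velocity hτ).of_le (by norm_cast)) (fun τ hτ => hcl.divFree τ hτ)
    (fun _ hτ x => curl_eq_zero_of_piercing_of_confinedNull hcl hΛc hΛ hS hconf hτ x)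

/-- **Classical irrotational members are trivial, EVERY `ρ > 0`** (the endgame of `…DSSCompactVorticity` isolated: the weak gradient
agrees a.e. with the classical, symmetric one, and the LEAD's `A`-gauge harmonic Liouville `ae_eq_zero_of_gauge_of_irrotational` applies).
[folklore] -/
-- adapted from …DSSCompactVorticity (`dss_ae_eq_zero_of_compactSupport_vorticity`, ns-typeII-p3)
theorem ae_eq_zero_of_gauge_of_classical_irrotational {ρ : ℝ} (hρ : 0 < ρ)
    {H : ℝ → EuclideanSpace ℝ (Fin 3) → EuclideanSpace ℝ (Fin 3) →L[ℝ] EuclideanSpace ℝ (Fin 3)} {c₀ : ℝ≥0}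
    (hsw : IsSuitableWeakSolutionOn (slab (EuclideanSpace ℝ (Fin 3)) (Iio 0) isOpen_Iio) 0 0 u p)
    (hH : HasWeakSpatialGradientOn (slab (EuclideanSpace ℝ (Fin 3)) (Iio 0) isOpen_Iio) u H)
    (hgauge : ∀ a : ℝ, 0 < a →
      ENNReal.ofReal (a ^ (2 * ρ)) * cknA a (0 : ℝ × EuclideanSpace ℝ (Fin 3)) u +
          ENNReal.ofReal (a ^ ρ) * cknE a (0 : ℝ × EuclideanSpace ℝ (Fin 3)) H +
        ENNReal.ofReal (a ^ (2 * ρ)) * cknD a (0 : ℝ × EuclideanSpace ℝ (Fin 3)) p ≤ (c₀ : ℝ≥0∞))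
    (hcl : IsClassicalEulerSolutionOn (Iio 0) 0 u p) (hcurl : ∀ τ : ℝ, τ < 0 → ∀ x, curl (u τ) x = 0) :
    uncurry u =ᵐ[volume.restrict (Iio (0 : ℝ) ×ˢ (univ : Set (EuclideanSpace ℝ (Fin 3))))] 0 := by
  -- the weak gradient agrees a.e. with the classical one, slice by slice
  have h1 := ae_hasWeakGradient_slice_of_slab hH
  have h2 : ∀ᵐ t ∂(volume.restrict (Iio (0 : ℝ))),
      (fun x => H t x) =ᵐ[volume] fun x => fderiv ℝ (u t) x := by
    filter_upwards [h1, ae_restrict_mem measurableSet_Iio] with t ht htneg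
    have hcl1 : ContDiff ℝ 1 (u t) := (hcl.contDiff_velocity htneg).of_le (by exact_mod_cast le_top)
    have hw : HasWeakGradient (u t) (fderiv ℝ (u t)) := hasWeakGradient_fderiv_of_contDiff hcl1
    have := HasWeakFDerivOn.unique_holds ht hw
    rwa [TopologicalSpace.Opens.coe_top, Measure.restrict_univ] at this
  have hμ : (volume : Measure (ℝ × EuclideanSpace ℝ (Fin 3))).restrict
      (Iio (0 : ℝ) ×ˢ (univ : Set (EuclideanSpace ℝ (Fin 3)))) =
      (volume.restrict (Iio (0 : ℝ))).prod (volume : Measure (EuclideanSpace ℝ (Fin 3))) := by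
    rw [Measure.volume_eq_prod, Measure.restrict_prod_eq_prod_univ]
  have hHm : AEStronglyMeasurable (uncurry H)
      ((volume.restrict (Iio (0 : ℝ))).prod (volume : Measure (EuclideanSpace ℝ (Fin 3)))) := by
    have := hH.locallyIntegrableOn_grad.aestronglyMeasurable
    rw [← hμ]; simpa [slab] using this
  have hGcont : ContinuousOn (uncurry fun t x => fderiv ℝ (u t) x)
      (Iio (0 : ℝ) ×ˢ (univ : Set (EuclideanSpace ℝ (Fin 3)))) :=
    (hcl.smooth_velocity.fderiv_slice isOpen_Iio.uniqueDiffOn).continuousOn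
  have hGm : AEStronglyMeasurable (uncurry fun t x => fderiv ℝ (u t) x)
      ((volume.restrict (Iio (0 : ℝ))).prod (volume : Measure (EuclideanSpace ℝ (Fin 3)))) := by
    rw [← hμ]
    exact hGcont.aestronglyMeasurable (measurableSet_Iio.prod MeasurableSet.univ)
  have hHG : uncurry H =ᵐ[(volume.restrict (Iio (0 : ℝ))).prod volume]
      uncurry fun t x => fderiv ℝ (u t) x :=
    ae_eq_prod_of_ae_ae_eq hHm hGm h2
  -- symmetry a.e. on the slab
  have hsym : ∀ᵐ z ∂(volume.restrict (Iio (0 : ℝ) ×ˢ (univ : Set (EuclideanSpace ℝ (Fin 3))))),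
      ∀ v w : EuclideanSpace ℝ (Fin 3), ⟪H z.1 z.2 v, w⟫ = ⟪H z.1 z.2 w, v⟫ := by
    rw [hμ]
    have hmem : ∀ᵐ z ∂((volume.restrict (Iio (0 : ℝ))).prod
        (volume : Measure (EuclideanSpace ℝ (Fin 3)))), z.1 < 0 := by
      rw [← hμ]
      filter_upwards [ae_restrict_mem (measurableSet_Iio.prod MeasurableSet.univ)] with z hz
      exact hz.1
    filter_upwards [hHG, hmem] with z hz hzneg v w
    have e : H z.1 z.2 = fderiv ℝ (u z.1) z.2 := hz
    rw [e]
    exact inner_fderiv_comm_of_curl_eq_zero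
      (((hcl.contDiff_velocity hzneg).differentiable (by simp)) z.2) (hcurl z.1 hzneg z.2) v w
  exact ae_eq_zero_of_gauge_of_irrotational (by linarith) hsw hH hgauge hsym

/-- **THE STRATUM MODULO THE CONFINED ALTERNATIVE, EVERY `ρ > 0`** (same as `ae_eq_zero_of_gauge_of_piercing_of_confinedNull` with the
all-`ρ` irrotational endgame). [folklore] -/
theorem ae_eq_zero_of_gauge_of_piercing_of_confinedNull_allRho {ρ : ℝ} (hρ : 0 < ρ)
    {H : ℝ → EuclideanSpace ℝ (Fin 3) → EuclideanSpace ℝ (Fin 3) →L[ℝ] EuclideanSpace ℝ (Fin 3)} {c₀ : ℝ≥0}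
    (hsw : IsSuitableWeakSolutionOn (slab (EuclideanSpace ℝ (Fin 3)) (Iio 0) isOpen_Iio) 0 0 u p)
    (hH : HasWeakSpatialGradientOn (slab (EuclideanSpace ℝ (Fin 3)) (Iio 0) isOpen_Iio) u H)
    (hgauge : ∀ a : ℝ, 0 < a →
      ENNReal.ofReal (a ^ (2 * ρ)) * cknA a (0 : ℝ × EuclideanSpace ℝ (Fin 3)) u +
          ENNReal.ofReal (a ^ ρ) * cknE a (0 : ℝ × EuclideanSpace ℝ (Fin 3)) H +
        ENNReal.ofReal (a ^ (2 * ρ)) * cknD a (0 : ℝ × EuclideanSpace ℝ (Fin 3)) p ≤ (c₀ : ℝ≥0∞))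
    (hcl : IsClassicalEulerSolutionOn (Iio 0) 0 u p) (hΛc : ContinuousOn Λ (Iio 0))
    (hΛ : ∀ s : ℝ, s < 0 → ∀ y, ‖fderiv ℝ (u s) y‖ ≤ Λ s)
    (hS : ∀ R₀ : ℝ, ∃ R : ℝ, R₀ ≤ R ∧ ∀ σ : ℝ, σ < 0 → ∀ x : EuclideanSpace ℝ (Fin 3), ‖x‖ = R * (-σ) ^ n →
      ⟪x, u σ x⟫ ≤ -(n * ‖x‖ ^ 2 / (-σ)) → curl (u σ) x = 0)
    (hconf : ∀ τ₀ : ℝ, τ₀ < 0 → ∀ R : ℝ, 0 < R →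
      volume {x : EuclideanSpace ℝ (Fin 3) | curl (u τ₀) x ≠ 0 ∧
        ∀ σ : ℝ, σ ≤ τ₀ → ‖ODE.evolutionMap u τ₀ σ x‖ < R * (-σ) ^ n} = 0) :
    uncurry u =ᵐ[volume.restrict (Iio (0 : ℝ) ×ˢ (univ : Set (EuclideanSpace ℝ (Fin 3))))] 0 :=
  ae_eq_zero_of_gauge_of_classical_irrotational hρ hsw hH hgauge hcl
    (fun _ hτ x => curl_eq_zero_of_piercing_of_confinedNull hcl hΛc hΛ hS hconf hτ x)

end Summit.NavierStokesRegularity.NavierStokesRegularity.Theorems.PowerGaugeEulerLiouville.MovingSpherePiercing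

end
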